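import Summits.ABC.IUTFork.Repair.CandJoshi9
import Summits.ABC.IUTFork.Repair.CandJoshi3Profile
import Summits.ABC.IUTFork.Cor312PilotKummerNaturalWitness
import Summits.ABC.IUTFork.Cor312UnitPositive
import HarnessLib

/-!
# IUT REPAIR branch (rung LADDER-ABC:A2.RP), rows RP-J01a/b/c + RP-J02a/b — PROFILE v0.4 CELLS on the beds P♮ (natural model) and U (unit
# shells: `uSetting`, `uLinkId`) for the five Joshi-shaped candidates

PROOF-ONLY record file (D-0012; no definition, no `Prop` fact) of the abc-iut cell, IUT REPAIR branch (seat abc-iut-rp-j1, on abc-iut-rp-plan's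
TASK RULINGS #24 (5), 2026-08-26T07:58Z: «`Repair/CandJoshi1Beds.lean` (proof-only): PROFILE v0.4 cells for J01a/b/c + J02a/b at P♮ (`natSetting`), U
(`uSetting`/`uLinkId`), and SCAL … one theorem per (row, bed), packaged»). TAKES NO SIDE on [IUTchIII] Cor. 3.12 and on no author; typed ≠ proved;
instantiated ≠ endorsed. Candidates (all `def … : Prop` reading predicates, never asserted): H_J1 `CandJoshi1.JoshiDominance`, H_J2
`CandJoshi1.JoshiVolumeDominance` (p427582), H_J2ᵖˡ `CandJoshi9.JoshiPlaceDominance` (p430632), H_J3 `CandJoshi3.LocusCovers`, H_J3′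
`CandJoshi3.ShellFilling` (p428372). Beds (cited BY NAME, not restated): **P♮** = abc-iut-w5-d230's NATURAL model (`Cor312PilotKummerNatural*`,
p429252/p429573/p429651: `natFull`, `natSetting`, operator `segRegion`, datum `qDatumNat`; typed Thm. 3.11, `BridgeHyps`, `AbsLogQPos`, the THREE
pins; the residual `S` HOLDS through a GENUINE sign indeterminacy (`flipFamily`), Statement strict; hull-sets `{0} ⊆ halfPos, halfNeg ⊆ ball ⊆ univ`);
**U** = abc-iut-w4-d101's UNIT shells (`Cor312UnitCountermodel` / `Cor312UnitPositive`, p429139/p429309: Ism = the `p`-adic units; `uSetting` = the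
unit-shell pinned countermodel (¬S, ¬Statement), `uLinkId` = its link-identified twin (S, Statement attained); operator `orbitRegion`, datum
`qDatum` resp. `(uLine p 0).Ψ`).

CELLS (kernel, standard axioms; one theorem per (row, bed), then packaged):
| bed | H_J1 | H_J2 | H_J2ᵖˡ | H_J3 | H_J3′ | how |
|---|---|---|---|---|---|---|
| P♮ `natSetting` | ✓ | ✓ | ✓ | ✓ | ✗ | S holds there ⟹ H_J1 (`joshiDominance_of_pilotKummerCompatRegion`) ⟹ H_J2 ⟹ H_J2ᵖˡ, R3 ⟹ H_J3; H_J3′ FAILS: at label 2 the hull-set `ball` lies between the Θ-image `halfPos` and the shell `ball` but the possible images are `{halfPos, halfNeg}` |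
| U `uSetting` | ✗ | ✗ | ✗ | ✗ | ✗ | the unit countermodel: ¬Hull / ¬Statement there; H_J3′: `B_1` between `B_4` and the shell `B_0` is no possible image |
| U `uLinkId` | ✓ | ✓ | ✓ | ✓ | ✗ | S holds (identified datum) ⟹ H_J1 ⟹ …; H_J3′ Θ-side only, FAILS as at `uSetting` |
SCAL (pinned setting over the scaling shells): OMITTED here per the ruling («if s3's/j2's lands in time, else omit») — the per-row scaling instance of
record for these rows is `Repair/CandJoshi7.lean` (p430052: R3 at every label through a non-isometric (Ind2), `−|log(Θ)| = +∞`) and rp-j2's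
`CandJoshi22*` (full-interface door witness). READING (neutral): on both non-(Ind)-trivial beds the four SUFFICIENT candidates track the residual
exactly where it holds (P♮, `uLinkId`) and fail with it where it fails (`uSetting`) — consistent with `CandJoshi1Order.joshi_chain` (S ⟹ H_J1 ⟹ …)
and with the rigidity of unit-ball models (`CandJoshi3Profile.joshiDominance_of_locusCovers_of_rigid`); the Θ-side filling H_J3′ fails on every bed
of record (cf. `CandJoshi3Profile.shellFilling_census`). Interface/toy level; no judgement on print.
[claim: Joshi2024ATSIII, status: disputed] [claim: Joshi2021ATSII, status: disputed]
-/

noncomputable section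

open Set

namespace Summit.ABC.IUTFork.Repair.CandJoshi1Beds

open Thm311 Cor312 Cor312.Checks Cor312.IdentifiedNonVacuity Cor312Vol Literature.IUT.LogThetaLattice
open Summit.ABC.IUTFork.Repair.CandJoshi1 Summit.ABC.IUTFork.Repair.CandJoshi3 Summit.ABC.IUTFork.Repair.CandJoshi9
open Summit.ABC.IUTFork.Repair.CandJoshi3Profile

/-! ## 1. Bed P♮ — the natural model (`natSetting`, `segRegion`, `qDatumNat`) -/

section Natural

open Cor312Vol.NaturalWitness Cor312Vol.NaiveWitness Cor312Vol.PinnedWitness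

/-- **P♮, RP-J01a: H_J1 HOLDS** (the residual's region form `PilotKummerCompatRegion` holds at P♮, abc-iut-w5-d230). [folklore] -/
theorem nat_joshiDominance : JoshiDominance natFull.toLatticeSituation natSetting segRegion qDatumNat :=
  joshiDominance_of_pilotKummerCompatRegion _ _ _ _ natSetting_pilotKummerCompatRegion

/-- **P♮, RP-J01b: H_J2 HOLDS** (from H_J1 under the pins and the bridge hypotheses of P♮). [folklore] -/
theorem nat_joshiVolumeDominance : JoshiVolumeDominance natSetting :=
  joshiVolumeDominance_of_joshiDominance _ _ _ _ natSetting_bridgeHyps natSetting_pinnedRegions3.1 nat_joshiDominance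

/-- **P♮, RP-J01c: H_J2ᵖˡ HOLDS** (label-sum of H_J2). [folklore] -/
theorem nat_placeDominance : JoshiPlaceDominance natSetting :=
  placeDominance_of_joshiVolumeDominance _ nat_joshiVolumeDominance

/-- **P♮, RP-J02a: H_J3 HOLDS** (READING R3 holds at P♮: the q-region `halfNeg` IS the possible image `flipFamily(halfPos)`). [folklore] -/
theorem nat_locusCovers : LocusCovers natFull.toLatticeSituation natSetting segRegion qDatumNat :=
  locusCovers_of_reading3 _ _ _ _ natSetting_qPinned natSetting_reading3

/-- **P♮, RP-J02b: H_J3′ FAILS** — at label `2` the hull-set `ball` contains the Θ-image `halfPos`, lies in the shell `ball`, and is NOT one of the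
two possible images `halfPos`, `halfNeg`. [folklore] -/
theorem nat_not_shellFilling : ¬ ShellFilling natFull.toLatticeSituation natSetting segRegion := by
  intro h
  have hj : (2 : toyIndex.Label) ≠ 0 := by decide
  have hH : ball 2 () ∈ (natSetting.frame 2 ()).Hul := ball_mem_natHul 2 ()
  have hlow : ∃ m : ℤ, segRegion ((natFull.toLatticeSituation.col natSetting.n).frobΨ m) 2 () ⊆ ball 2 () := by
    refine ⟨0, ?_⟩
    rw [← natSetting_thetaPinned.2 0 2 ()]
    refine (Set.subset_iUnion (fun m : ℤ => natSetting.thetaRegion m 2 ()) 0).trans ?_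
    show natSetting.thetaRegion3 2 () ⊆ ball 2 ()
    rw [(natSetting_regions_of_ne_zero hj ()).1]
    exact halfPos_subset_ball 2 ()
  have hup : ball 2 () ⊆ (natFull.toLatticeSituation.D natSetting.n).shellPk 2 () := fun x hx => hx
  have hmem := h 2 () _ hH hlow hup
  rw [natSetting_possibleImages hj] at hmem
  rcases hmem with h1 | h2
  · exact (natHul_not_subset 2 ()).2.2.2.2.1 h1.subset
  · exact (natHul_not_subset 2 ()).2.2.2.2.2.1 (Set.mem_singleton_iff.1 h2).subset

/-- **P♮ cells, packaged** (with the bed's interface clauses of record: typed Thm. 3.11, bridge hypotheses, `|log(q)| > 0`, three pins, the residual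
`S` and the Statement all HOLD at P♮). [folklore] -/
theorem nat_cells :
    natFull.Statement ∧ BridgeHyps natSetting ∧ natSetting.AbsLogQPos ∧
      PinnedRegions3 natFull.toLatticeSituation natSetting segRegion qDatumNat ∧
      PilotKummerIndRelated natFull.toLatticeSituation natSetting segRegion qDatumNat ∧
      JoshiDominance natFull.toLatticeSituation natSetting segRegion qDatumNat ∧ JoshiVolumeDominance natSetting ∧
      JoshiPlaceDominance natSetting ∧ LocusCovers natFull.toLatticeSituation natSetting segRegion qDatumNat ∧
      ¬ ShellFilling natFull.toLatticeSituation natSetting segRegion :=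
  ⟨natFull_statement, natSetting_bridgeHyps, natSetting_absLogQPos, natSetting_pinnedRegions3, natSetting_pilotKummerIndRelated,
    nat_joshiDominance, nat_joshiVolumeDominance, nat_placeDominance, nat_locusCovers, nat_not_shellFilling⟩

end Natural

/-! ## 2. Bed U — the unit shells: the unit countermodel `uSetting` and its link-identified twin `uLinkId` -/

section Units

open Cor312Vol.UnitWitness Cor312Vol.NaiveWitness Cor312Vol.PinnedWitness

variable (p : ℕ) [hp : Fact p.Prime]

/-- **U `uSetting`, RP-J01a: H_J1 FAILS** (the hull-level clause fails at the unit countermodel; H_J1 would give it under the Θ-pin). [folklore] -/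
theorem u_not_joshiDominance : ¬ JoshiDominance (uFull p).toLatticeSituation (uSetting p) (orbitRegion p) (qDatum p) := fun h =>
  uSetting_not_pilotKummerCompatHull p (pilotKummerCompatHull_of_joshiDominance _ _ _ _ (uSetting_thetaPinned p) h)

/-- **U `uSetting`, RP-J01b: H_J2 FAILS** (it would give the Statement, false at the unit countermodel). [folklore] -/
theorem u_not_joshiVolumeDominance : ¬ JoshiVolumeDominance (uSetting p) := fun h =>
  uSetting_not_statement p (statement_of_joshiVolumeDominance _ (uSetting_bridgeHyps p) h)

/-- **U `uSetting`, RP-J01c: H_J2ᵖˡ FAILS** (same route). [folklore] -/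
theorem u_not_placeDominance : ¬ JoshiPlaceDominance (uSetting p) := fun h =>
  uSetting_not_statement p (statement_of_placeDominance _ (uSetting_bridgeHyps p) h)

/-- **U `uSetting`, RP-J02a: H_J3 FAILS** (it would give the hull-level clause). [folklore] -/
theorem u_not_locusCovers : ¬ LocusCovers (uFull p).toLatticeSituation (uSetting p) (orbitRegion p) (qDatum p) := fun h =>
  uSetting_not_pilotKummerCompatHull p (hull_of_locusCovers _ _ _ _ h)

/-- **U `uSetting`, RP-J02b: H_J3′ FAILS** — at label `2` the ball `B_1` contains the Θ-image `B_4`, lies in the shell `B_0`, and is not the possible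
image `B_4` (the unit indeterminacies fix every ball). [folklore] -/
theorem u_not_shellFilling : ¬ ShellFilling (uFull p).toLatticeSituation (uSetting p) (orbitRegion p) := by
  intro h
  have hj : jsq (2 : toyIndex.Label) = 4 := by decide
  have hH : uBall p 2 () 1 ∈ ((uSetting p).frame 2 ()).Hul := uBall_mem_hul p 2 () 1
  have hlow : ∃ m : ℤ, orbitRegion p (((uFull p).toLatticeSituation.col (uSetting p).n).frobΨ m) 2 () ⊆ uBall p 2 () 1 := by
    refine ⟨0, ?_⟩
    rw [← (uSetting_thetaPinned p).2 0 2 (), uSetting_thetaRegion, hj]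
    exact uBall_mono p 2 () (by norm_num)
  have hup : uBall p 2 () 1 ⊆ ((uFull p).toLatticeSituation.D (uSetting p).n).shellPk 2 () := by
    have hs : ((uFull p).toLatticeSituation.D (uSetting p).n).shellPk 2 () = uBall p 2 () 0 := uLine_shellPk p _ 2 ()
    rw [hs]
    exact uBall_mono p 2 () (by norm_num)
  have hmem := h 2 () _ hH hlow hup
  rw [uSetting_possibleImages, Set.mem_singleton_iff, hj] at hmem
  have := uBall_injective p 2 () hmem
  omega

/-- **U `uSetting` cells, packaged**: typed Thm. 3.11, bridge hypotheses, `|log(q)| > 0`, three pins HOLD; the residual, the Statement and ALL FIVE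
Joshi-shaped candidates FAIL (the unit twin of the T-b cells at the sign countermodel). [folklore] -/
theorem uSetting_cells :
    (uFull p).Statement ∧ BridgeHyps (uSetting p) ∧ (uSetting p).AbsLogQPos ∧
      PinnedRegions3 (uFull p).toLatticeSituation (uSetting p) (orbitRegion p) (qDatum p) ∧
      ¬ PilotKummerIndRelated (uFull p).toLatticeSituation (uSetting p) (orbitRegion p) (qDatum p) ∧ ¬ (uSetting p).Statement ∧
      ¬ JoshiDominance (uFull p).toLatticeSituation (uSetting p) (orbitRegion p) (qDatum p) ∧ ¬ JoshiVolumeDominance (uSetting p) ∧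
      ¬ JoshiPlaceDominance (uSetting p) ∧ ¬ LocusCovers (uFull p).toLatticeSituation (uSetting p) (orbitRegion p) (qDatum p) ∧
      ¬ ShellFilling (uFull p).toLatticeSituation (uSetting p) (orbitRegion p) :=
  ⟨uFull_statement p, uSetting_bridgeHyps p, uSetting_absLogQPos p, uSetting_pinnedRegions3 p, uSetting_not_pilotKummerIndRelated p,
    uSetting_not_statement p, u_not_joshiDominance p, u_not_joshiVolumeDominance p, u_not_placeDominance p, u_not_locusCovers p,
    u_not_shellFilling p⟩

/-- **U `uLinkId`, RP-J01a: H_J1 HOLDS** (the link-identified datum: `PilotKummerCompatRegion` holds, abc-iut-w4-d101). [folklore] -/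
theorem uLinkId_joshiDominance : JoshiDominance (uFull p).toLatticeSituation (uLinkId p) (orbitRegion p) (uLine p 0).Ψ :=
  joshiDominance_of_pilotKummerCompatRegion _ _ _ _ (uLinkId_pilotKummerCompatRegion p)

/-- **U `uLinkId`, RP-J01b: H_J2 HOLDS.** [folklore] -/
theorem uLinkId_joshiVolumeDominance : JoshiVolumeDominance (uLinkId p) :=
  joshiVolumeDominance_of_joshiDominance _ _ _ _ (uWithQDatum_bridgeHyps p _ _) (uWithQDatum_pinnedRegions3 p _ _).1
    (uLinkId_joshiDominance p)

/-- **U `uLinkId`, RP-J01c: H_J2ᵖˡ HOLDS.** [folklore] -/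
theorem uLinkId_placeDominance : JoshiPlaceDominance (uLinkId p) :=
  placeDominance_of_joshiVolumeDominance _ (uLinkId_joshiVolumeDominance p)

/-- **U `uLinkId`, RP-J02a: H_J3 HOLDS** (from H_J1 under the Θ-pin). [folklore] -/
theorem uLinkId_locusCovers : LocusCovers (uFull p).toLatticeSituation (uLinkId p) (orbitRegion p) (uLine p 0).Ψ :=
  locusCovers_of_joshiDominance _ _ _ _ (uWithQDatum_thetaPinned p _ _) (uLinkId_joshiDominance p)

/-- **U `uLinkId`, RP-J02b: H_J3′ FAILS** (Θ-side only: the same Θ-images, frames and shell as `uSetting`). [folklore] -/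
theorem uLinkId_not_shellFilling : ¬ ShellFilling (uFull p).toLatticeSituation (uLinkId p) (orbitRegion p) := by
  intro h
  have hj : jsq (2 : toyIndex.Label) = 4 := by decide
  have hH : uBall p 2 () 1 ∈ ((uLinkId p).frame 2 ()).Hul := uBall_mem_hul p 2 () 1
  have hlow : ∃ m : ℤ, orbitRegion p (((uFull p).toLatticeSituation.col (uLinkId p).n).frobΨ m) 2 () ⊆ uBall p 2 () 1 := by
    refine ⟨0, ?_⟩
    rw [← (uWithQDatum_thetaPinned p (uLine p 0).Ψ (uLineZero_hul p)).2 0 2 (), uWithQDatum_thetaRegion, hj]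
    exact uBall_mono p 2 () (by norm_num)
  have hup : uBall p 2 () 1 ⊆ ((uFull p).toLatticeSituation.D (uLinkId p).n).shellPk 2 () := by
    have hs : ((uFull p).toLatticeSituation.D (uLinkId p).n).shellPk 2 () = uBall p 2 () 0 := uLine_shellPk p _ 2 ()
    rw [hs]
    exact uBall_mono p 2 () (by norm_num)
  have hmem := h 2 () _ hH hlow hup
  rw [uWithQDatum_possibleImages, Set.mem_singleton_iff, hj] at hmem
  have := uBall_injective p 2 () hmem
  omega

/-- **U `uLinkId` cells, packaged**: typed Thm. 3.11, bridge hypotheses, `|log(q)| > 0`, three pins, the residual and the Statement HOLD; H_J1, H_J2,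
H_J2ᵖˡ, H_J3 HOLD; H_J3′ FAILS. [folklore] -/
theorem uLinkId_cells :
    (uFull p).Statement ∧ BridgeHyps (uLinkId p) ∧ (uLinkId p).AbsLogQPos ∧
      PinnedRegions3 (uFull p).toLatticeSituation (uLinkId p) (orbitRegion p) (uLine p 0).Ψ ∧
      PilotKummerIndRelated (uFull p).toLatticeSituation (uLinkId p) (orbitRegion p) (uLine p 0).Ψ ∧ (uLinkId p).Statement ∧
      JoshiDominance (uFull p).toLatticeSituation (uLinkId p) (orbitRegion p) (uLine p 0).Ψ ∧ JoshiVolumeDominance (uLinkId p) ∧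
      JoshiPlaceDominance (uLinkId p) ∧ LocusCovers (uFull p).toLatticeSituation (uLinkId p) (orbitRegion p) (uLine p 0).Ψ ∧
      ¬ ShellFilling (uFull p).toLatticeSituation (uLinkId p) (orbitRegion p) :=
  ⟨uFull_statement p, uWithQDatum_bridgeHyps p _ _, uLinkId_absLogQPos p, uWithQDatum_pinnedRegions3 p _ _, uLinkId_pilotKummerIndRelated p,
    uLinkId_statement p, uLinkId_joshiDominance p, uLinkId_joshiVolumeDominance p, uLinkId_placeDominance p, uLinkId_locusCovers p,
    uLinkId_not_shellFilling p⟩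

end Units

end Summit.ABC.IUTFork.Repair.CandJoshi1Beds

end
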